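import Summits.RiemannHypothesis.RiemannHypothesis.Theorems.TiltedLandingLaw421R3LooseRecut
import Summits.RiemannHypothesis.RiemannHypothesis.Theorems.TiltedLandingLaw421R3TouchedGlueHCount

/-!
# TiltedLandingLaw421R3LooseRecutAdapt — the LOOSE re-cut's Γ-side glue at FIT″ / FIT‴ (lens-2 g9, image O10-b; director-rh head 2026-08-31T09:01Z; SUPPORT)

TWO imports, both TREE: `…R3LooseRecut` (#1218, the re-cut Ac′ and `law421R_of_recut`) and `…R3TouchedGlueHCount` (#1217, FIT‴; it imports #1213 FIT″).
GLUE only (K): no new law, no registry move, no new definition.  The line of record is `Cruxes/TiltedLandingLaw421R/Lines/trkD_v11q.lean`; ★A's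
decomposition of record is rev 7.3 (`RhW08.TouchedGlueHCount.approachC_of_TH_count_canonical`).  This module states the SAME decomposition for the
re-cut stub Ac′ = `RhW08.LooseRecut.ApproachRecutAllowanceQ c (BetaLevelQ κ₀) (approachBudgetHalfQ aR aC)` of the v12q candidate:

  §A1 Γ4 ⟹ Γ4′: the rest law over `(Approach ∧ ¬Loose) ∖ β` is never harder than Γ4's over `Approach ∖ β` (the removed loose levels have books summand
      `1 − 4·dropQ/s ≥ 0` by the subsidy clause) — `rest'_of_rest`; so every Γ4 bench / allowance of record transfers to Γ4′ verbatim.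
  §A2 FIT″ shape (frame-adaptive β debit, #1213): `approachRecut_of_TH_adaptive` (+ `_canonical`) — #1218's `approachRecut_of_TH` with
      `betaClassLaw_of_TH …` replaced by `classLawQ_betaUsed (betaClassLaw_of_TH …)`.
  §A3 FIT‴ shape (count-capped β debit, #1217): `approachRecut_of_TH_count` (+ `_canonical`, and the fit-free `_residual` with Γ4′ typed against
      `restResidualQ κ₀ cF L aT (approachBudgetHalfQ aR aC)`).
  §A4 monotonicity read-backs: FIT_W ⟹ FIT″ ⟹ FIT‴ (tree `fitW_implies_fitAdaptive`, `fitAdaptive_implies_fitCount`) hence #1218's §L6 binders feed §A3.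
  §A5 the crux BY NAME from the v12q stub set with Ac′ DECOMPOSED: TopPinning, RegUmbrella11S, F1, F2c, Cc, and (hcF, hL, T★, Γ3″, Γ4′-residual) —
      `law421R_of_recut_count` (a CONDITIONAL composition; it credits nothing by itself).

BINDERS (Γ-side, names as in #1205/#1213/#1217): hcF : `cF > 0` on legal frames · hL : `0 ≤ L` · hT : `TouchedDissipationLawWQ cF L κ₀` (T★) ·
hrise : `TouchRiseLawHQ cF L κ₀ aT` (Γ3″) · hrest : `ClassLawQ (diffClass (diffClass ApproachLevelQ (LooseLevelQ c (BetaLevelQ κ₀))) (BetaLevelQ κ₀)) aRest` (Γ4′,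
COUNT-typed; or its residual form) · hfit″ / hfit‴ as in #1213 / #1217 with the SAME allowance literal `approachBudgetHalfQ aR aC`.

Nothing here bears on the truth of RH; RH is not proved; F1 / F2c / Cc / Ac′ / T★ / Γ3″ / Γ4′ / FIT‴ are typed OPEN hypotheses; ★A / 33346 / 33347 OPEN;
checked ≠ landed ≠ proved.
-/

namespace RhW08.LooseRecutAdapt

open RhW08.Round1 RhW08.StSwap RhW08.Round2 RhW08.QuadW
open RhW08.SealSwap (PBot)
open RhW08.SealSwapQ RhW08.RateSplit RhW08.BurgersRate RhW08.BurgersRateG3 RhW08.TouchedDissipation RhW08.TouchedDissipationW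
open RhIdea6.G17.W07C7 RhIdea6.G17.W07C7.Rev6 RhIdea6.G18.W07C8.Law421BirthS RhIdea6.G19.W07C11.Seam
open RhIdea6.G20.W07C12.Frac RhIdea6.G20.W07C12.StColP RhW07.C12.FieldSplit RhIdea6.G21.W07C13.TentMax
open RhW07.C14.TwoSided RhW07.C14.Classes RhW07.C14.Lineage RhW07.C14.Booking
open RhW08.PurseP RhW08.TouchedGlueW RhW08.TouchedGlueH RhW08.TouchedGlueHAdapt RhW08.TouchedGlueHCount RhW08.LooseRecut

/-! ## §A1 Γ4 ⟹ Γ4′ -/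

/-- ★ (K) §A1 **Γ4 ⟹ Γ4′**: a rest law over `Approach ∖ β` gives the rest law over `(Approach ∧ ¬Loose) ∖ β` at the SAME allowance — the loose levels
removed from the class have non-negative books summands (subsidy clause `4·dropQ ≤ s` of `LooseLevelQ`). -/
theorem rest'_of_rest {c κ₀ : ℝ} {aRest : Budget} (h : ClassLawQ (diffClass ApproachLevelQ (BetaLevelQ κ₀)) aRest) :
    ClassLawQ (diffClass (diffClass ApproachLevelQ (LooseLevelQ c (BetaLevelQ κ₀))) (BetaLevelQ κ₀)) aRest := by
  intro η f x₀ s hmax R Hs B hE k hk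
  have hs : 0 < s := hE.2.2.2.1
  have h1 : netCostQ (diffClass ApproachLevelQ (BetaLevelQ κ₀)) η f x₀ s hmax R Hs B (k + 1) ≤ aRest η f x₀ s hmax R Hs B :=
    h η f x₀ s hmax R Hs B hE k hk
  -- `Approach ∖ β` = `((Approach ∧ ¬Loose) ∖ β) ∪ (Approach ∖ β)`, and the difference class consists of loose levels
  have hU : unionClass (diffClass (diffClass ApproachLevelQ (LooseLevelQ c (BetaLevelQ κ₀))) (BetaLevelQ κ₀))
      (diffClass ApproachLevelQ (BetaLevelQ κ₀)) = diffClass ApproachLevelQ (BetaLevelQ κ₀) := by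
    funext η f x₀ s hmax R Hs B j
    exact propext ⟨fun hx => hx.elim (fun hl => ⟨hl.1.1, hl.2⟩) id, fun hx => Or.inr hx⟩
  have h2 := netCostQ_union (diffClass (diffClass ApproachLevelQ (LooseLevelQ c (BetaLevelQ κ₀))) (BetaLevelQ κ₀))
    (diffClass ApproachLevelQ (BetaLevelQ κ₀)) η f x₀ s hmax R Hs B (k + 1)
  rw [hU] at h2
  have h3 : 0 ≤ netCostQ (diffClass (diffClass ApproachLevelQ (BetaLevelQ κ₀))
      (diffClass (diffClass ApproachLevelQ (LooseLevelQ c (BetaLevelQ κ₀))) (BetaLevelQ κ₀))) η f x₀ s hmax R Hs B (k + 1) := by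
    unfold netCostQ
    refine Finset.sum_nonneg fun j _ => ?_
    split_ifs with hx
    · obtain ⟨_, ⟨hA, hnβ⟩, hnot⟩ := hx
      have hL : LooseLevelQ c (BetaLevelQ κ₀) η f x₀ s hmax R Hs B j := by
        by_contra hL
        exact hnot ⟨⟨hA, hL⟩, hnβ⟩
      obtain ⟨_, _, hsub, _⟩ := hL
      rw [sub_nonneg, div_le_one hs]
      exact hsub
    · exact le_rfl
  show netCostQ (diffClass (diffClass ApproachLevelQ (LooseLevelQ c (BetaLevelQ κ₀))) (BetaLevelQ κ₀)) η f x₀ s hmax R Hs B (k + 1)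
    ≤ aRest η f x₀ s hmax R Hs B
  linarith

/-! ## §A2 the re-cut converter at FIT″ (frame-adaptive β debit) -/

/-- ★★ (K, modulo the NAMED hypotheses) §A2 **Ac′ from the Γ-side at FIT″**: W(cF) with `cF > 0` on legal frames + (Γ3″) + (Γ4′) + FIT″ (the β purse and `aT`
reserved ONLY on frames with a charged β-level) ⟹ `ApproachRecutAllowanceQ c (BetaLevelQ κ₀) (approachBudgetHalfQ aR aC)` for ANY budgets `aR aC`. -/
theorem approachRecut_of_TH_adaptive {cF : Budget} {L κ₀ c : ℝ} {aT aRest aR aC : Budget}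
    (hcF : ∀ (η : ℝ) (f : ℂ → ℂ) (x₀ s hmax R Hs : ℝ) (B : ℕ), EngineHyps5 2 η f x₀ s hmax R Hs B → 0 < cF η f x₀ s hmax R Hs B)
    (hL : 0 ≤ L) (hT : TouchedDissipationLawWQ cF L κ₀) (hrise : TouchRiseLawHQ cF L κ₀ aT)
    (hrest : ClassLawQ (diffClass (diffClass ApproachLevelQ (LooseLevelQ c (BetaLevelQ κ₀))) (BetaLevelQ κ₀)) aRest)
    (hfit : ∀ (η : ℝ) (f : ℂ → ℂ) (x₀ s hmax R Hs : ℝ) (B : ℕ), EngineHyps5 2 η f x₀ s hmax R Hs B →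
      betaUsedQ κ₀ (addBudget (betaPurseWQ cF L) aT) η f x₀ s hmax R Hs B + aRest η f x₀ s hmax R Hs B
        ≤ approachBudgetHalfQ aR aC η f x₀ s hmax R Hs B) :
    ApproachRecutAllowanceQ c (BetaLevelQ κ₀) (approachBudgetHalfQ aR aC) :=
  classLawQ_mono (approachRecut_of_beta_rest (classLawQ_betaUsed (betaClassLaw_of_TH hcF hL hT hrise)) hrest)
    (fun η f x₀ s hmax R Hs B hE => by
      show betaUsedQ κ₀ (addBudget (betaPurseWQ cF L) aT) η f x₀ s hmax R Hs B + aRest η f x₀ s hmax R Hs B ≤ _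
      exact hfit η f x₀ s hmax R Hs B hE)

/-- ★★ (K) §A2 the CANONICAL instance — the v12q candidate's `stub_approachRecutC` allowance literal `approachBudgetHalfQ riseSupQ consSupQ`. -/
theorem approachRecut_of_TH_adaptive_canonical {cF : Budget} {L κ₀ c : ℝ} {aT aRest : Budget}
    (hcF : ∀ (η : ℝ) (f : ℂ → ℂ) (x₀ s hmax R Hs : ℝ) (B : ℕ), EngineHyps5 2 η f x₀ s hmax R Hs B → 0 < cF η f x₀ s hmax R Hs B)
    (hL : 0 ≤ L) (hT : TouchedDissipationLawWQ cF L κ₀) (hrise : TouchRiseLawHQ cF L κ₀ aT)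
    (hrest : ClassLawQ (diffClass (diffClass ApproachLevelQ (LooseLevelQ c (BetaLevelQ κ₀))) (BetaLevelQ κ₀)) aRest)
    (hfit : ∀ (η : ℝ) (f : ℂ → ℂ) (x₀ s hmax R Hs : ℝ) (B : ℕ), EngineHyps5 2 η f x₀ s hmax R Hs B →
      betaUsedQ κ₀ (addBudget (betaPurseWQ cF L) aT) η f x₀ s hmax R Hs B + aRest η f x₀ s hmax R Hs B
        ≤ approachBudgetHalfQ riseSupQ consSupQ η f x₀ s hmax R Hs B) :
    ApproachRecutAllowanceQ c (BetaLevelQ κ₀) (approachBudgetHalfQ riseSupQ consSupQ) :=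
  approachRecut_of_TH_adaptive hcF hL hT hrise hrest hfit

/-! ## §A3 the re-cut converter at FIT‴ (count-capped β debit) -/

/-- ★★ (K, modulo the NAMED hypotheses) §A3 **Ac′ from the Γ-side at FIT‴**: W(cF) with `cF > 0` on legal frames + (Γ3″) + (Γ4′) + FIT‴ (the β purse reserved
only on frames with a charged β-level, and CAPPED by their number when finite) ⟹ `ApproachRecutAllowanceQ c (BetaLevelQ κ₀) (approachBudgetHalfQ aR aC)`. -/
theorem approachRecut_of_TH_count {cF : Budget} {L κ₀ c : ℝ} {aT aRest aR aC : Budget}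
    (hcF : ∀ (η : ℝ) (f : ℂ → ℂ) (x₀ s hmax R Hs : ℝ) (B : ℕ), EngineHyps5 2 η f x₀ s hmax R Hs B → 0 < cF η f x₀ s hmax R Hs B)
    (hL : 0 ≤ L) (hT : TouchedDissipationLawWQ cF L κ₀) (hrise : TouchRiseLawHQ cF L κ₀ aT)
    (hrest : ClassLawQ (diffClass (diffClass ApproachLevelQ (LooseLevelQ c (BetaLevelQ κ₀))) (BetaLevelQ κ₀)) aRest)
    (hfit : ∀ (η : ℝ) (f : ℂ → ℂ) (x₀ s hmax R Hs : ℝ) (B : ℕ), EngineHyps5 2 η f x₀ s hmax R Hs B →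
      betaUsedQ κ₀ (addBudget (betaCountCapQ κ₀ (betaPurseWQ cF L)) aT) η f x₀ s hmax R Hs B + aRest η f x₀ s hmax R Hs B
        ≤ approachBudgetHalfQ aR aC η f x₀ s hmax R Hs B) :
    ApproachRecutAllowanceQ c (BetaLevelQ κ₀) (approachBudgetHalfQ aR aC) :=
  classLawQ_mono (approachRecut_of_beta_rest (betaClassLaw_of_TH_count hcF hL hT hrise) hrest)
    (fun η f x₀ s hmax R Hs B hE => by
      show betaUsedQ κ₀ (addBudget (betaCountCapQ κ₀ (betaPurseWQ cF L)) aT) η f x₀ s hmax R Hs B + aRest η f x₀ s hmax R Hs B ≤ _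
      exact hfit η f x₀ s hmax R Hs B hE)

/-- ★★ (K) §A3 the CANONICAL instance at FIT‴ — allowance literal `approachBudgetHalfQ riseSupQ consSupQ`. -/
theorem approachRecut_of_TH_count_canonical {cF : Budget} {L κ₀ c : ℝ} {aT aRest : Budget}
    (hcF : ∀ (η : ℝ) (f : ℂ → ℂ) (x₀ s hmax R Hs : ℝ) (B : ℕ), EngineHyps5 2 η f x₀ s hmax R Hs B → 0 < cF η f x₀ s hmax R Hs B)
    (hL : 0 ≤ L) (hT : TouchedDissipationLawWQ cF L κ₀) (hrise : TouchRiseLawHQ cF L κ₀ aT)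
    (hrest : ClassLawQ (diffClass (diffClass ApproachLevelQ (LooseLevelQ c (BetaLevelQ κ₀))) (BetaLevelQ κ₀)) aRest)
    (hfit : ∀ (η : ℝ) (f : ℂ → ℂ) (x₀ s hmax R Hs : ℝ) (B : ℕ), EngineHyps5 2 η f x₀ s hmax R Hs B →
      betaUsedQ κ₀ (addBudget (betaCountCapQ κ₀ (betaPurseWQ cF L)) aT) η f x₀ s hmax R Hs B + aRest η f x₀ s hmax R Hs B
        ≤ approachBudgetHalfQ riseSupQ consSupQ η f x₀ s hmax R Hs B) :
    ApproachRecutAllowanceQ c (BetaLevelQ κ₀) (approachBudgetHalfQ riseSupQ consSupQ) :=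
  approachRecut_of_TH_count hcF hL hT hrise hrest hfit

/-- ★★ (K, modulo the NAMED hypotheses) §A3 **Ac′ with Γ4′ RESIDUAL-TYPED** — NO fit hypothesis: Γ4′ stated against
`restResidualQ κ₀ cF L aT (approachBudgetHalfQ aR aC)` (the allowance minus the count-capped frame-adaptive β debit). -/
theorem approachRecut_of_TH_count_residual {cF : Budget} {L κ₀ c : ℝ} {aT aR aC : Budget}
    (hcF : ∀ (η : ℝ) (f : ℂ → ℂ) (x₀ s hmax R Hs : ℝ) (B : ℕ), EngineHyps5 2 η f x₀ s hmax R Hs B → 0 < cF η f x₀ s hmax R Hs B)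
    (hL : 0 ≤ L) (hT : TouchedDissipationLawWQ cF L κ₀) (hrise : TouchRiseLawHQ cF L κ₀ aT)
    (hrest : ClassLawQ (diffClass (diffClass ApproachLevelQ (LooseLevelQ c (BetaLevelQ κ₀))) (BetaLevelQ κ₀))
      (restResidualQ κ₀ cF L aT (approachBudgetHalfQ aR aC))) :
    ApproachRecutAllowanceQ c (BetaLevelQ κ₀) (approachBudgetHalfQ aR aC) :=
  approachRecut_of_TH_count hcF hL hT hrise hrest (fun η f x₀ s hmax R Hs B _ => fitCount_residual κ₀ cF L aT _ η f x₀ s hmax R Hs B)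

/-! ## §A4 monotonicity read-backs (the count converter is never weaker than #1218's §L6) -/

/-- (K) §A4 #1218's FIT_W-shaped binders (with the reserved amount `betaPurseWQ cF L F + aT F ≥ 0` on legal frames) feed the FIT‴ converter:
FIT_W ⟹ FIT″ ⟹ FIT‴ (`fitW_implies_fitAdaptive`, `fitAdaptive_implies_fitCount`). -/
theorem approachRecut_count_of_W {cF : Budget} {L κ₀ c : ℝ} {aT aRest aR aC : Budget}
    (hcF : ∀ (η : ℝ) (f : ℂ → ℂ) (x₀ s hmax R Hs : ℝ) (B : ℕ), EngineHyps5 2 η f x₀ s hmax R Hs B → 0 < cF η f x₀ s hmax R Hs B)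
    (hL : 0 ≤ L) (hT : TouchedDissipationLawWQ cF L κ₀) (hrise : TouchRiseLawHQ cF L κ₀ aT)
    (hrest : ClassLawQ (diffClass (diffClass ApproachLevelQ (LooseLevelQ c (BetaLevelQ κ₀))) (BetaLevelQ κ₀)) aRest)
    (h0 : ∀ (η : ℝ) (f : ℂ → ℂ) (x₀ s hmax R Hs : ℝ) (B : ℕ), EngineHyps5 2 η f x₀ s hmax R Hs B →
      0 ≤ betaPurseWQ cF L η f x₀ s hmax R Hs B + aT η f x₀ s hmax R Hs B)
    (hfit : ∀ (η : ℝ) (f : ℂ → ℂ) (x₀ s hmax R Hs : ℝ) (B : ℕ), EngineHyps5 2 η f x₀ s hmax R Hs B →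
      betaPurseWQ cF L η f x₀ s hmax R Hs B + aT η f x₀ s hmax R Hs B + aRest η f x₀ s hmax R Hs B
        ≤ approachBudgetHalfQ aR aC η f x₀ s hmax R Hs B) :
    ApproachRecutAllowanceQ c (BetaLevelQ κ₀) (approachBudgetHalfQ aR aC) :=
  approachRecut_of_TH_count hcF hL hT hrise hrest (fitAdaptive_implies_fitCount (fitW_implies_fitAdaptive h0 hfit))

/-- (K) §A4 Γ4 (over `Approach ∖ β`) in place of Γ4′ also feeds the FIT‴ converter (`rest'_of_rest`): the v11q-side benches of Γ4 transfer. -/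
theorem approachRecut_of_TH_count_rest {cF : Budget} {L κ₀ c : ℝ} {aT aRest aR aC : Budget}
    (hcF : ∀ (η : ℝ) (f : ℂ → ℂ) (x₀ s hmax R Hs : ℝ) (B : ℕ), EngineHyps5 2 η f x₀ s hmax R Hs B → 0 < cF η f x₀ s hmax R Hs B)
    (hL : 0 ≤ L) (hT : TouchedDissipationLawWQ cF L κ₀) (hrise : TouchRiseLawHQ cF L κ₀ aT)
    (hrest : ClassLawQ (diffClass ApproachLevelQ (BetaLevelQ κ₀)) aRest)
    (hfit : ∀ (η : ℝ) (f : ℂ → ℂ) (x₀ s hmax R Hs : ℝ) (B : ℕ), EngineHyps5 2 η f x₀ s hmax R Hs B →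
      betaUsedQ κ₀ (addBudget (betaCountCapQ κ₀ (betaPurseWQ cF L)) aT) η f x₀ s hmax R Hs B + aRest η f x₀ s hmax R Hs B
        ≤ approachBudgetHalfQ aR aC η f x₀ s hmax R Hs B) :
    ApproachRecutAllowanceQ c (BetaLevelQ κ₀) (approachBudgetHalfQ aR aC) :=
  approachRecut_of_TH_count hcF hL hT hrise (rest'_of_rest hrest) hfit

/-! ## §A5 the crux BY NAME from the v12q stub set with Ac′ decomposed (rev 7.3′) -/

/-- ★★★ (K, CONDITIONAL composition) §A5 **v12q with Ac′ DECOMPOSED at FIT‴ (residual-typed)**: TopPinning + RegUmbrella11S + F1 + F2c + Cc + (`cF > 0` on legal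
frames, `0 ≤ L`, T★, Γ3″, Γ4′ against `restResidualQ κ₀ cF L aT (approachBudgetHalfQ riseSupQ consSupQ)`) ⟹ the crux `TiltedLandingLaw421R` BY NAME
(`law421R_of_recut (BetaLevelQ κ₀)` ∘ `approachRecut_of_TH_count_residual`, at the instance `c := 4/5`). -/
theorem law421R_of_recut_count {cF : Budget} {L κ₀ : ℝ} {aT : Budget}
    (hP : RhW08.Lens1Pinning.TopPinning) (hU : RhW08.Lens1Pinning.RegUmbrella11S)
    (hR2 : FarEnergyLawCQ (4 / 5)) (hr : EnergyRiseLawQ riseSupQ) (hC : ConsLawQ consSupQ)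
    (hcF : ∀ (η : ℝ) (f : ℂ → ℂ) (x₀ s hmax R Hs : ℝ) (B : ℕ), EngineHyps5 2 η f x₀ s hmax R Hs B → 0 < cF η f x₀ s hmax R Hs B)
    (hL : 0 ≤ L) (hT : TouchedDissipationLawWQ cF L κ₀) (hrise : TouchRiseLawHQ cF L κ₀ aT)
    (hrest : ClassLawQ (diffClass (diffClass ApproachLevelQ (LooseLevelQ (4 / 5) (BetaLevelQ κ₀))) (BetaLevelQ κ₀))
      (restResidualQ κ₀ cF L aT (approachBudgetHalfQ riseSupQ consSupQ))) :
    Summit.RiemannHypothesis.RiemannHypothesis.Theses.EarlyAppointments.TiltedLandingLaw421R :=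
  law421R_of_recut (BetaLevelQ κ₀) hP hU hR2 hr hC (approachRecut_of_TH_count_residual hcF hL hT hrise hrest)

end RhW08.LooseRecutAdapt
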